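import Mathlib
import Literature.Analysis.PDE.InverseSquareChannelEstimate
import Literature.Analysis.ODE.InverseCoordSmooth
import Literature.Analysis.PDE.Wave1DFarComparisonLimits
import Literature.Analysis.PDE.FarChannelClaimLemmas
import Literature.Analysis.PDE.FarChannelClaimLemmas2
import Literature.Analysis.PDE.FarKernelSpanLemmas
import Literature.Analysis.PDE.FarChannelClaimZeroLemmas
import HarnessLib

/-!
# The far-side channel claim for exponent `n = 0`: constants and the Hardy inequality

Analysis/PDE support file (everything proved). For `n = 0` the exact potential vanishes, the exact
channel estimate controls `∫ h'² + g²` of the far data directly, and the only kernel direction is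
the true counterpart `B⁰₀ ≈ 1` of the constants. `far_channel_claim_zero`: with
`P = q`, `0 ≤ q ≤ ε z^{-5/2}` beyond `3/8` and `ε² ≤ r ∫_1^2 P`, for every `φ` as in
`FarChannelClaim.lean` and `δ > 0`, the combination `a · B⁰₀` with `a = φ(0,1)` satisfies
`∫_{z>1} e_P[φ − a B⁰₀](0) ≤ A (L⁺ + L⁻) + Θ (ε + r) E_d + δ`. Ingredients: the exact estimate
(`InverseSquareChannelEstimate.lean`, `n = 0`), the Duhamel comparison with `V₀ = 0`, `σ = 5/4`
(`Wave1DFarComparisonLimits.lean`), the Hardy inequality on `(1,∞)` (`FarChannelClaimZeroLemmas.lean`) and the bound `φ(0,1)² ∫_1^2 P ≤ 2E_d + 2ε ∫ h'²`. Route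
PhotonSphereChannels, `FixedModeChannels`, far side, `ℓ = 0` (stmt-FinalStateConjecture-10048).
Folklore in method.
-/

noncomputable section

namespace Literature.Analysis.PDE

open MeasureTheory Set Filter Topology Finset Real Literature.Analysis.ODE
  Literature.Analysis.Calculus

/-- **Exact-comparison package for `n = 0`.** From the exact (`V₀ = 0`) channel estimate and the
comparison of limits: the data `(h, g) = (φ(0,·), φ_t(0,·))` satisfy
`c₃ ∫_1^X (h'² + g²) ≤ S` for all `X ≥ 1` with `0 ≤ S ≤ 2(L⁺' + L⁻') + 256 ε E_d + δ₁`. [folklore] -/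
theorem far_claim_zero_exact :
    ∃ c₃ : ℝ, 0 < c₃ ∧ ∀ {P : ℝ → ℝ} {ε : ℝ} {φ F : ℝ → ℝ → ℝ} {Lp' Lm' δ₁ : ℝ},
      Continuous P → (∀ z, 0 ≤ P z) → 0 ≤ ε →
      (∀ z, 1 ≤ z → P z ≤ ε * z ^ (-(5 : ℝ) / 2)) →
      ContDiff ℝ 2 (Function.uncurry φ) → Continuous (Function.uncurry F) →
      (∀ t z, iteratedDeriv 2 (fun τ => φ τ z) t - iteratedDeriv 2 (φ t) z + P z * φ t z = F t z) →
      (∀ τ z, 1 ≤ z → F τ z = 0) →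
      (∫⁻ z in Ioi 1, ENNReal.ofReal
        (deriv (fun τ => φ τ z) 0 ^ 2 + deriv (φ 0) z ^ 2 + P z * φ 0 z ^ 2)) < ⊤ →
      Tendsto (fun t => ∫ z in Ioi (1 + |t|),
        (deriv (fun τ => φ τ z) t ^ 2 + deriv (φ t) z ^ 2 + P z * φ t z ^ 2)) atTop (𝓝 Lp') →
      Tendsto (fun t => ∫ z in Ioi (1 + |t|),
        (deriv (fun τ => φ τ z) t ^ 2 + deriv (φ t) z ^ 2 + P z * φ t z ^ 2)) atBot (𝓝 Lm') →
      0 < δ₁ →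
      ContDiff ℝ 2 (φ 0) ∧ ContDiff ℝ 1 (fun x => deriv (fun τ => φ τ x) 0) ∧
      IntegrableOn (fun x => deriv (φ 0) x ^ 2) (Ioi 1) ∧
      IntegrableOn (fun z => deriv (fun τ => φ τ z) 0 ^ 2 + deriv (φ 0) z ^ 2 + P z * φ 0 z ^ 2)
        (Ioi 1) ∧
      ∃ S : ℝ, 0 ≤ S ∧
        S ≤ 2 * (Lp' + Lm') + 256 * ε * (∫ z in Ioi 1,
          (deriv (fun τ => φ τ z) 0 ^ 2 + deriv (φ 0) z ^ 2 + P z * φ 0 z ^ 2)) + δ₁ ∧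
        (∀ X, 1 ≤ X → c₃ * ∫ x in (1:ℝ)..X,
          (deriv (φ 0) x ^ 2 + deriv (fun τ => φ τ x) 0 ^ 2) ≤ S) ∧
        (∫ x in Ioi 1, deriv (φ 0) x ^ 2) ≤ S / c₃ := by
  obtain ⟨ι, hι, hιeq, -, I, hI, hI'⟩ := exists_smooth_inv_extension
  obtain ⟨c₃, hc₃, hV3⟩ := inverseSquare_channel_estimate hι hιeq hI hI' 0
  refine ⟨c₃, hc₃, ?_⟩
  intro P ε φ F Lp' Lm' δ₁ hPc hP0 hε hPb hφ hF hres hF0 hfin hLp' hLm' hδ₁0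
  -- the (vanishing) exact potential
  set V₀ : ℝ → ℝ := fun x => ((0:ℕ) : ℝ) * ((0:ℕ) + 1) * ι x ^ 2 with hV₀
  have hV₀z : ∀ x, V₀ x = 0 := fun x => by simp [hV₀]
  have hV₀c : Continuous V₀ := continuous_const.mul (hι.continuous.pow 2)
  have hV₀0 : ∀ x, 0 ≤ V₀ x := fun x => by rw [hV₀z]
  -- data
  obtain ⟨hh, hg, i1, -, -, hint, -⟩ := far_data_facts hPc hP0 hφ hfin (W := V₀) hV₀c hV₀0
    (fun z _ => by rw [hV₀z]; linarith [hP0 z])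
  set Ed : ℝ := ∫ z in Ioi 1, (deriv (fun τ => φ τ z) 0 ^ 2 + deriv (φ 0) z ^ 2 + P z * φ 0 z ^ 2)
    with hEd
  refine ⟨hh, hg, i1, hint, ?_⟩
  -- the exact comparison wave and the comparison of limits (`V₀ = 0`, `σ = 5/4`, `δ² = ε`)
  obtain ⟨φ₀, Lp, Lm, hφ₀C, hφ₀sol, hφ₀0, hφ₀1, hLp0, hLm0, hTp, hTm, hδV3⟩ :=
    hV3 (φ 0) (fun x => deriv (fun τ => φ τ x) 0) hh hg i1
      (by refine (integrableOn_zero).congr_fun (fun x _ => ?_) measurableSet_Ioi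
          show (0:ℝ) = V₀ x * φ 0 x ^ 2; rw [hV₀z, zero_mul])
      ((far_data_facts hPc hP0 hφ hfin (W := V₀) hV₀c hV₀0
        (fun z _ => by rw [hV₀z]; linarith [hP0 z])).2.2.2.2.1)
  obtain ⟨hF₀c, hF₀0⟩ := inverseSquare_residual (W := V₀) hV₀c hφ₀C hφ₀sol
  have hdata : ∀ x, φ₀ 0 x = φ 0 x ∧ deriv (fun τ => φ₀ τ x) 0 = deriv (fun τ => φ τ x) 0 :=
    fun x => ⟨hφ₀0 x, hφ₀1 x⟩
  have hqc : ∀ x, 1 ≤ x → (V₀ x - P x) ^ 2 ≤ Real.sqrt ε ^ 2 * x ^ (-(2 * (5 / 4 : ℝ))) * P x := by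
    intro x hx
    rw [hV₀z, Real.sq_sqrt hε, show -(2 * (5 / 4 : ℝ)) = -(5 : ℝ) / 2 by norm_num]
    have h1 := hPb x hx
    have hPx := hP0 x
    calc (0 - P x) ^ 2 = P x * P x := by ring
      _ ≤ (ε * x ^ (-(5 : ℝ) / 2)) * P x := mul_le_mul_of_nonneg_right h1 hPx
      _ = ε * x ^ (-(5 : ℝ) / 2) * P x := by ring
  have hVP : ∀ x, 1 ≤ x → V₀ x ≤ (1 + 0) * P x := fun x _ => by rw [hV₀z]; linarith [hP0 x]
  have hLpb : Lp ≤ 2 * (1 + 0) * Lp' + 8 * Real.sqrt ε ^ 2 / (5 / 4 - 1) ^ 2 * Ed :=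
    wave1D_far_limits_comparison hV₀c hV₀0 hPc hP0 hφ hF hres hF0 hφ₀C hF₀c (fun t x => rfl)
      (fun τ x hx => hF₀0 τ x hx) hdata (Real.sqrt_nonneg ε) (by norm_num) le_rfl hqc hVP hfin hTp
      hLp'
  have hLmb : Lm ≤ 2 * (1 + 0) * Lm' + 8 * Real.sqrt ε ^ 2 / (5 / 4 - 1) ^ 2 * Ed :=
    wave1D_far_limits_comparison hV₀c hV₀0 hPc hP0 hφ hF hres hF0 hφ₀C hF₀c (fun t x => rfl)
      (fun τ x hx => hF₀0 τ x hx) hdata (Real.sqrt_nonneg ε) (by norm_num) le_rfl hqc hVP hfin hTm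
      hLm'
  -- the exact estimate at accuracy `δ₁`: `c₃ ∫_1^X (h'² + g²) ≤ S`
  obtain ⟨ch, cg, hX⟩ := hδV3 δ₁ hδ₁0
  set S : ℝ := Lp + Lm + δ₁ with hS
  have hS0 : 0 ≤ S := by simp only [hS]; linarith
  have hSb : S ≤ 2 * (Lp' + Lm') + 256 * ε * Ed + δ₁ := by
    have e : (8 : ℝ) * Real.sqrt ε ^ 2 / (5 / 4 - 1) ^ 2 = 128 * ε := by
      rw [Real.sq_sqrt hε]; ring
    rw [e] at hLpb hLmb
    simp only [hS]; linarith
  have hX' : ∀ X, 1 ≤ X → c₃ * ∫ x in (1:ℝ)..X, (deriv (φ 0) x ^ 2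
      + deriv (fun τ => φ τ x) 0 ^ 2) ≤ S := by
    intro X hX1
    refine le_of_eq_of_le ?_ (hX X hX1)
    congr 1
    refine intervalIntegral.integral_congr fun x _ => ?_
    have e1 : (fun y => φ 0 y - ladder ι 0 (fun z => ∑ m ∈ range (0 + 1),
        ch m / m.factorial * (z - 1) ^ m) y) = fun y => φ 0 y - ch 0 := by
      funext y; simp [ladder_zero]
    simp only [e1, deriv_sub_const]
    simp [ladder_zero]
  -- `∫_{Ioi 1} h'² ≤ S / c₃`
  have hcHG : Continuous fun x => deriv (φ 0) x ^ 2 + deriv (fun τ => φ τ x) 0 ^ 2 :=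
    ((hh.continuous_deriv (by norm_num)).pow 2).add (hg.continuous.pow 2)
  obtain ⟨hHGi, hHG⟩ := integrableOn_Ioi_of_intervalIntegral_le hcHG (fun x _ => by positivity)
    (M := S / c₃) (fun X hX1 => by rw [le_div_iff₀ hc₃]; linarith [hX' X hX1])
  have hHle : (∫ x in Ioi 1, deriv (φ 0) x ^ 2) ≤ S / c₃ :=
    (setIntegral_mono_on i1 hHGi measurableSet_Ioi fun x _ => by nlinarith).trans hHG
  exact ⟨S, hS0, hSb, hX', hHle⟩

/-- **Assembly step for `n = 0`**: the comparison of the data energies of `φ` and a `C²` kernel `k`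
with `ε`-close data (`far_claim_compare` with `V₀ := P`, `L₁ := a`, `L₂ := 0`) and the final
arithmetic. [folklore] -/
theorem far_claim_zero_assemble {P : ℝ → ℝ} {φ k : ℝ → ℝ → ℝ}
    {a ε r c₃ Kc S H Ed L δ δ₁ : ℝ} (hPc : Continuous P) (hP0 : ∀ z, 0 ≤ P z)
    (hφ : ContDiff ℝ 2 (Function.uncurry φ)) (hkC : ContDiff ℝ 2 (Function.uncurry k))
    (hc₃ : 0 < c₃) (hKc : 0 ≤ Kc) (hε : 0 ≤ ε) (hε1 : ε ≤ 1) (hr : 0 ≤ r) (hr1 : r ≤ 1)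
    (hEd0 : 0 ≤ Ed) (hH0 : 0 ≤ H) (hS0 : 0 ≤ S)
    (hX' : ∀ X, 1 ≤ X → c₃ * ∫ x in (1:ℝ)..X,
      (deriv (φ 0) x ^ 2 + deriv (fun τ => φ τ x) 0 ^ 2) ≤ S)
    (hIPi : IntegrableOn (fun x => P x * (φ 0 x - a) ^ 2) (Ioi 1))
    (hIP : (∫ x in Ioi 1, P x * (φ 0 x - a) ^ 2) ≤ 2 * ε * H)
    (hJI : IntegrableOn (fun z => deriv (k 0) z ^ 2 + P z * (k 0 z - a) ^ 2
      + deriv (fun τ => k τ z) 0 ^ 2) (Ioi 1))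
    (hJ : (∫ z in Ioi 1, (deriv (k 0) z ^ 2 + P z * (k 0 z - a) ^ 2
      + deriv (fun τ => k τ z) 0 ^ 2)) ≤ Kc * ε ^ 2 * a ^ 2)
    (hHle : H ≤ S / c₃) (ha2 : ε ^ 2 * a ^ 2 ≤ r * (2 * Ed + 2 * ε * H))
    (hSb : S ≤ 2 * L + 256 * ε * Ed + δ₁) (hδ₁' : (6 + 4 * Kc) / c₃ * δ₁ ≤ δ) :
    IntegrableOn (fun z => deriv (fun τ => φ τ z - k τ z) 0 ^ 2
      + deriv (fun y => φ 0 y - k 0 y) z ^ 2 + P z * (φ 0 z - k 0 z) ^ 2) (Ioi 1) ∧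
    (∫ z in Ioi 1, (deriv (fun τ => φ τ z - k τ z) 0 ^ 2
      + deriv (fun y => φ 0 y - k 0 y) z ^ 2 + P z * (φ 0 z - k 0 z) ^ 2))
      ≤ 2 * (6 + 4 * Kc) / c₃ * L + (256 * (6 + 4 * Kc) / c₃ + 4 * Kc) * (ε + r) * Ed + δ := by
  have hh : ContDiff ℝ 2 (φ 0) := hφ.comp (contDiff_const.prodMk contDiff_id)
  obtain ⟨φt', -, -, -, -, hctφ, -, -, -, -, hφ1, -, -, -, -, -, -, -⟩ :=
    exists_partials_of_contDiff_two hφ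
  have hg : Continuous fun x => deriv (fun τ => φ τ x) 0 := by
    have : (fun x => deriv (fun τ => φ τ x) 0) = fun x => φt' 0 x := funext fun x => (hφ1 0 x).deriv
    rw [this]; exact hctφ.comp (continuous_const.prodMk continuous_id)
  -- regularity of the data of `k`
  obtain ⟨kt, -, -, -, -, hctk, -, -, -, -, hk1, -, -, -, -, -, -, -⟩ :=
    exists_partials_of_contDiff_two hkC
  have hk0c : Continuous (k 0) := (contDiff_two_slices'' hkC 0 0).2.continuous
  have hkzc : Continuous (deriv (k 0)) := (contDiff_two_slices'' hkC 0 0).2.continuous_deriv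
    (by norm_num)
  have hktc : Continuous fun z => deriv (fun τ => k τ z) 0 := by
    have : (fun z => deriv (fun τ => k τ z) 0) = fun z => kt 0 z := funext fun z => (hk1 0 z).deriv
    rw [this]; exact hctk.comp (continuous_const.prodMk continuous_id)
  have hcHG : Continuous fun x => deriv (φ 0) x ^ 2 + deriv (fun τ => φ τ x) 0 ^ 2 :=
    ((hh.continuous_deriv (by norm_num)).pow 2).add (hg.pow 2)
  -- `c₃ ∫_1^X E_P[(h − a, g)] ≤ (1 + 2ε) S`
  have hS' : ∀ X, 1 ≤ X → c₃ * ∫ x in (1:ℝ)..X, (deriv (fun y => φ 0 y - (fun _ => a) y) x ^ 2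
      + P x * (φ 0 x - (fun _ => a) x) ^ 2
      + ((fun x => deriv (fun τ => φ τ x) 0) x - (fun _ => (0:ℝ)) x) ^ 2) ≤ (1 + 2 * ε) * S := by
    intro X hX1
    have hIPX : (∫ x in (1:ℝ)..X, P x * (φ 0 x - a) ^ 2) ≤ 2 * ε * H := by
      rw [intervalIntegral.integral_of_le hX1]
      exact (setIntegral_mono_set hIPi (ae_of_all _ fun x => mul_nonneg (hP0 x) (sq_nonneg _))
        (ae_of_all _ Ioc_subset_Ioi_self)).trans hIP
    have hci : IntervalIntegrable (fun x => deriv (φ 0) x ^ 2 + deriv (fun τ => φ τ x) 0 ^ 2)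
        volume 1 X := hcHG.intervalIntegrable _ _
    have hcp : IntervalIntegrable (fun x => P x * (φ 0 x - a) ^ 2) volume 1 X :=
      (hPc.mul ((hh.continuous.sub continuous_const).pow 2)).intervalIntegrable _ _
    have e : (∫ x in (1:ℝ)..X, (deriv (fun y => φ 0 y - (fun _ => a) y) x ^ 2
        + P x * (φ 0 x - (fun _ => a) x) ^ 2
        + ((fun x => deriv (fun τ => φ τ x) 0) x - (fun _ => (0:ℝ)) x) ^ 2))
        = (∫ x in (1:ℝ)..X, (deriv (φ 0) x ^ 2 + deriv (fun τ => φ τ x) 0 ^ 2))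
          + ∫ x in (1:ℝ)..X, P x * (φ 0 x - a) ^ 2 := by
      rw [← intervalIntegral.integral_add hci hcp]
      refine intervalIntegral.integral_congr fun x _ => ?_
      simp only [deriv_sub_const, sub_zero]; ring
    rw [e, mul_add]
    have h1 := hX' X hX1
    have h2 : c₃ * (∫ x in (1:ℝ)..X, P x * (φ 0 x - a) ^ 2) ≤ 2 * ε * S := by
      calc c₃ * (∫ x in (1:ℝ)..X, P x * (φ 0 x - a) ^ 2) ≤ c₃ * (2 * ε * H) :=
            mul_le_mul_of_nonneg_left hIPX hc₃.le
        _ ≤ 2 * ε * S := by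
            have := mul_le_mul_of_nonneg_left hHle (by positivity : (0:ℝ) ≤ 2 * ε * c₃)
            rw [show 2 * ε * c₃ * (S / c₃) = 2 * ε * S by field_simp] at this
            linarith
    linarith
  have hJI' : IntegrableOn (fun z => (deriv (k 0) z - deriv (fun _ : ℝ => a) z) ^ 2
      + P z * (k 0 z - (fun _ => a) z) ^ 2
      + (deriv (fun τ => k τ z) 0 - (fun _ => (0:ℝ)) z) ^ 2) (Ioi 1) := by
    refine hJI.congr_fun (fun z _ => ?_) measurableSet_Ioi
    simp only [deriv_const', sub_zero]
  have hJ' : (∫ z in Ioi 1, ((deriv (k 0) z - deriv (fun _ : ℝ => a) z) ^ 2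
      + P z * (k 0 z - (fun _ => a) z) ^ 2
      + (deriv (fun τ => k τ z) 0 - (fun _ => (0:ℝ)) z) ^ 2)) ≤ Kc * ε ^ 2 * a ^ 2 := by
    refine le_of_eq_of_le (setIntegral_congr_fun measurableSet_Ioi fun z _ => ?_) hJ
    simp only [deriv_const', sub_zero]
  obtain ⟨hEI, hEle⟩ := far_claim_compare (h := φ 0) (g := fun x => deriv (fun τ => φ τ x) 0)
    (L₁ := fun _ => a) (L₂ := fun _ => 0) (V₀ := P) (k₀ := k 0) (kz := deriv (k 0))
    (kt := fun z => deriv (fun τ => k τ z) 0) (ε := 0) hPc hP0 hPc hP0 le_rfl hc₃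
    (fun x _ => by linarith) (hh.of_le (by norm_num)) hg contDiff_const continuous_const
    hk0c hkzc hktc (S := (1 + 2 * ε) * S) hS' hJI' hJ'
  -- identify the energy of `φ − k`
  have hdφ : ∀ z, DifferentiableAt ℝ (fun τ => φ τ z) 0 ∧ DifferentiableAt ℝ (φ 0) z := fun z =>
    ⟨(contDiff_two_slices'' hφ 0 z).1.differentiable (by norm_num) 0,
      (contDiff_two_slices'' hφ 0 z).2.differentiable (by norm_num) z⟩
  have hdk : ∀ z, DifferentiableAt ℝ (fun τ => k τ z) 0 ∧ DifferentiableAt ℝ (k 0) z := fun z =>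
    ⟨(contDiff_two_slices'' hkC 0 z).1.differentiable (by norm_num) 0,
      (contDiff_two_slices'' hkC 0 z).2.differentiable (by norm_num) z⟩
  have hEeq : (fun z => deriv (fun τ => φ τ z - k τ z) 0 ^ 2 + deriv (fun y => φ 0 y - k 0 y) z ^ 2
      + P z * (φ 0 z - k 0 z) ^ 2) = fun z => ((fun x => deriv (fun τ => φ τ x) 0) z
        - (fun z => deriv (fun τ => k τ z) 0) z) ^ 2
        + (deriv (φ 0) z - deriv (k 0) z) ^ 2 + P z * (φ 0 z - k 0 z) ^ 2 := by
    funext z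
    rw [deriv_fun_sub (hdφ z).1 (hdk z).1, deriv_fun_sub (hdφ z).2 (hdk z).2]
  refine ⟨by rw [hEeq]; exact hEI, ?_⟩
  rw [hEeq]
  exact far_claim_zero_arith hc₃ hKc hε hε1 hr hr1 hEd0 hH0 hS0 hEle hHle ha2 hSb hδ₁'

/-- **The far-side channel claim for `n = 0`.** See the module docstring. [folklore] -/
theorem far_channel_claim_zero (n : ℕ) (hn : n = 0) {Kc : ℝ} (hKc : 0 ≤ Kc) :
    ∃ A Θ : ℝ, 0 ≤ A ∧ 0 ≤ Θ ∧ ∀ {P q : ℝ → ℝ} {ε r : ℝ}, Continuous P → (∀ z, 0 ≤ P z) →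
      Continuous q → 0 ≤ ε → ε ≤ 1 / 64 → 0 ≤ r → r ≤ 1 →
      (∀ z, 3 / 8 ≤ z → P z = (n : ℝ) * (n + 1) / z ^ 2 + q z) →
      (∀ z, 3 / 8 ≤ z → |q z| ≤ ε * z ^ (-(5 : ℝ) / 2)) →
      (ε ^ 2 ≤ r * ∫ x in (1:ℝ)..2, P x) →
    ∀ (B : ℕ → ℕ → ℝ → ℝ → ℝ),
      (∀ α β : ℕ → ℝ,
        let k : ℝ → ℝ → ℝ := fun t z =>
          ∑ m ∈ range (n + 1), α m * B 0 m t z + ∑ m ∈ range n, β m * B 1 m t z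
        ContDiff ℝ 2 (Function.uncurry k) ∧
        ((∀ m, Odd m → α m = 0) → (∀ m, Odd m → β m = 0) →
          IntegrableOn (fun z =>
            (deriv (k 0) z - ∑ m ∈ range (n + 1), α m * ((m : ℝ) - n) * z ^ ((m : ℝ) - n - 1)) ^ 2
            + P z * (k 0 z - ∑ m ∈ range (n + 1), α m * z ^ ((m : ℝ) - n)) ^ 2
            + (deriv (fun τ => k τ z) 0 - ∑ m ∈ range n, β m * z ^ ((m : ℝ) - n)) ^ 2) (Ioi 1) ∧
          (∫ z in Ioi 1,
            ((deriv (k 0) z - ∑ m ∈ range (n + 1), α m * ((m : ℝ) - n) * z ^ ((m : ℝ) - n - 1)) ^ 2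
            + P z * (k 0 z - ∑ m ∈ range (n + 1), α m * z ^ ((m : ℝ) - n)) ^ 2
            + (deriv (fun τ => k τ z) 0 - ∑ m ∈ range n, β m * z ^ ((m : ℝ) - n)) ^ 2))
            ≤ Kc * ε ^ 2 * (∑ m ∈ range (n + 1), α m ^ 2 + ∑ m ∈ range n, β m ^ 2))) →
    ∀ (φ F : ℝ → ℝ → ℝ), ContDiff ℝ 2 (Function.uncurry φ) → Continuous (Function.uncurry F) →
      (∀ t z, iteratedDeriv 2 (fun τ => φ τ z) t - iteratedDeriv 2 (φ t) z + P z * φ t z = F t z) →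
      (∀ τ z, 1 ≤ z → F τ z = 0) →
      (∫⁻ z in Ioi 1, ENNReal.ofReal
        (deriv (fun τ => φ τ z) 0 ^ 2 + deriv (φ 0) z ^ 2 + P z * φ 0 z ^ 2)) < ⊤ →
    ∀ (Lp' Lm' : ℝ),
      Tendsto (fun t => ∫ z in Ioi (1 + |t|),
        (deriv (fun τ => φ τ z) t ^ 2 + deriv (φ t) z ^ 2 + P z * φ t z ^ 2)) atTop (𝓝 Lp') →
      Tendsto (fun t => ∫ z in Ioi (1 + |t|),
        (deriv (fun τ => φ τ z) t ^ 2 + deriv (φ t) z ^ 2 + P z * φ t z ^ 2)) atBot (𝓝 Lm') →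
    ∀ δ : ℝ, 0 < δ → ∃ a : ℝ,
      IntegrableOn (fun z =>
        deriv (fun τ => φ τ z - (∑ m ∈ range (n + 1), (if m = 0 then a else 0) * B 0 m τ z
          + ∑ m ∈ range n, (0:ℝ) * B 1 m τ z)) 0 ^ 2
        + deriv (fun y => φ 0 y - (∑ m ∈ range (n + 1), (if m = 0 then a else 0) * B 0 m 0 y
          + ∑ m ∈ range n, (0:ℝ) * B 1 m 0 y)) z ^ 2
        + P z * (φ 0 z - (∑ m ∈ range (n + 1), (if m = 0 then a else 0) * B 0 m 0 z
          + ∑ m ∈ range n, (0:ℝ) * B 1 m 0 z)) ^ 2) (Ioi 1) ∧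
      (∫ z in Ioi 1, (deriv (fun τ => φ τ z - (∑ m ∈ range (n + 1),
          (if m = 0 then a else 0) * B 0 m τ z + ∑ m ∈ range n, (0:ℝ) * B 1 m τ z)) 0 ^ 2
        + deriv (fun y => φ 0 y - (∑ m ∈ range (n + 1), (if m = 0 then a else 0) * B 0 m 0 y
          + ∑ m ∈ range n, (0:ℝ) * B 1 m 0 y)) z ^ 2
        + P z * (φ 0 z - (∑ m ∈ range (n + 1), (if m = 0 then a else 0) * B 0 m 0 z
          + ∑ m ∈ range n, (0:ℝ) * B 1 m 0 z)) ^ 2))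
        ≤ A * (Lp' + Lm') + Θ * (ε + r) * (∫ z in Ioi 1,
            (deriv (fun τ => φ τ z) 0 ^ 2 + deriv (φ 0) z ^ 2 + P z * φ 0 z ^ 2)) + δ := by
  subst hn
  -- constants
  obtain ⟨c₃, hc₃, hexact⟩ := far_claim_zero_exact
  set A₂ : ℝ := (6 + 4 * Kc) / c₃ with hA₂
  have hA₂0 : 0 ≤ A₂ := by positivity
  refine ⟨2 * (6 + 4 * Kc) / c₃, 256 * (6 + 4 * Kc) / c₃ + 4 * Kc, by positivity, by positivity, ?_⟩
  intro P q ε r hPc hP0 hq hε hε1 hr hr1 hPq hqb hrP B hcombo φ F hφ hF hres hF0 hfin Lp' Lm' hLp'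
    hLm' δ hδ
  have hε1' : ε ≤ 1 := by linarith
  -- the potential on `z ≥ 1`
  have hPz : ∀ z, 1 ≤ z → P z ≤ ε * z ^ (-(5 : ℝ) / 2) ∧ P z ≤ ε := by
    intro z hz
    have hz0 : 0 < z := by linarith
    have hP : P z = q z := by rw [hPq z (by linarith)]; simp
    have h1 : P z ≤ ε * z ^ (-(5 : ℝ) / 2) := hP ▸ (le_abs_self _).trans (hqb z (by linarith))
    have h2 : z ^ (-(5 : ℝ) / 2) ≤ 1 := rpow_le_one_of_one_le_of_nonpos hz (by norm_num)
    exact ⟨h1, h1.trans (by nlinarith)⟩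
  have hPb : ∀ x, 1 ≤ x → P x ≤ ε * x ^ (-(5 : ℝ) / 2) := fun x hx => (hPz x hx).1
  -- accuracy `δ₁` and the exact package
  set δ₁ : ℝ := δ / (A₂ + 1) with hδ₁
  have hδ₁0 : 0 < δ₁ := by positivity
  have hδ₁' : A₂ * δ₁ ≤ δ := by
    have hA1 : 0 < A₂ + 1 := by linarith
    rw [hδ₁, mul_div_assoc', div_le_iff₀ hA1]
    have : δ * (A₂ + 1) = A₂ * δ + δ := by ring
    rw [this]; linarith
  obtain ⟨hh, hg, i1, hint, S, hS0, hSb, hX', hHle⟩ :=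
    hexact hPc hP0 hε hPb hφ hF hres hF0 hfin hLp' hLm' hδ₁0
  set Ed : ℝ := ∫ z in Ioi 1, (deriv (fun τ => φ τ z) 0 ^ 2 + deriv (φ 0) z ^ 2 + P z * φ 0 z ^ 2)
    with hEd
  have hEd0 : 0 ≤ Ed := setIntegral_nonneg measurableSet_Ioi fun z _ =>
    wave1D_energyDensity_nonneg hP0 0 z
  set H : ℝ := ∫ x in Ioi 1, deriv (φ 0) x ^ 2 with hHdef
  have hH0 : 0 ≤ H := setIntegral_nonneg measurableSet_Ioi fun x _ => sq_nonneg _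
  -- the kernel direction `a · B⁰₀`, `a = h(1)`
  set a : ℝ := φ 0 1 with ha
  obtain ⟨hkC, hkcl⟩ := hcombo (fun m => if m = 0 then a else 0) (fun _ => 0)
  have hoddα : ∀ m, Odd m → (fun m => if m = 0 then a else (0:ℝ)) m = 0 := by
    intro m hm
    show (if m = 0 then a else (0:ℝ)) = 0
    rw [if_neg]; rintro rfl; exact (Nat.not_odd_iff_even.2 (by decide)) hm
  obtain ⟨hJI, hJ⟩ := hkcl hoddα (fun _ _ => rfl)
  set k : ℝ → ℝ → ℝ := fun t z => ∑ m ∈ range (0 + 1), (if m = 0 then a else 0) * B 0 m t z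
    + ∑ m ∈ range 0, (0:ℝ) * B 1 m t z with hk
  have hJfun : (fun z => (deriv (k 0) z - ∑ m ∈ range (0 + 1), (if m = 0 then a else 0)
      * ((m : ℝ) - (0:ℕ)) * z ^ ((m : ℝ) - (0:ℕ) - 1)) ^ 2
      + P z * (k 0 z - ∑ m ∈ range (0 + 1), (if m = 0 then a else 0) * z ^ ((m : ℝ) - (0:ℕ))) ^ 2
      + (deriv (fun τ => k τ z) 0 - ∑ m ∈ range 0, (0:ℝ) * z ^ ((m : ℝ) - (0:ℕ))) ^ 2)
      = fun z => deriv (k 0) z ^ 2 + P z * (k 0 z - a) ^ 2 + deriv (fun τ => k τ z) 0 ^ 2 := by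
    funext z; simp
  have hsq : ∑ m ∈ range (0 + 1), (fun m => if m = 0 then a else (0:ℝ)) m ^ 2
      + ∑ m ∈ range 0, (fun _ => (0:ℝ)) m ^ 2 = a ^ 2 := by simp
  rw [hJfun] at hJI hJ
  rw [hsq] at hJ
  -- Hardy: `∫ P (h − a)² ≤ 2 ε H`, and the size of the constant direction
  obtain ⟨hIPi, hIP⟩ := far_zero_hardy hPc hP0 hPb (hh.of_le (by norm_num)) i1
  have ha2 : ε ^ 2 * a ^ 2 ≤ r * (2 * Ed + 2 * ε * H) :=
    far_claim_zero_direction hPc hP0 hh i1 hint (fun x hx => (hPz x hx).2) hr hrP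
  -- assemble
  obtain ⟨hI, hB⟩ := far_claim_zero_assemble (k := k) (L := Lp' + Lm') hPc hP0 hφ hkC hc₃ hKc hε
    hε1' hr hr1 hEd0 hH0 hS0 hX' hIPi hIP hJI hJ hHle ha2 hSb hδ₁'
  exact ⟨a, hI, hB⟩

/-- `far_channel_claim_zero` at the literal exponent `0` (the form used downstream). [folklore] -/
theorem far_channel_claim_zero₀ {Kc : ℝ} (hKc : 0 ≤ Kc) :
    ∃ A Θ : ℝ, 0 ≤ A ∧ 0 ≤ Θ ∧ ∀ {P q : ℝ → ℝ} {ε r : ℝ}, Continuous P → (∀ z, 0 ≤ P z) →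
      Continuous q → 0 ≤ ε → ε ≤ 1 / 64 → 0 ≤ r → r ≤ 1 →
      (∀ z, 3 / 8 ≤ z → P z = ((0:ℕ) : ℝ) * ((0:ℕ) + 1) / z ^ 2 + q z) →
      (∀ z, 3 / 8 ≤ z → |q z| ≤ ε * z ^ (-(5 : ℝ) / 2)) →
      (ε ^ 2 ≤ r * ∫ x in (1:ℝ)..2, P x) →
    ∀ (B : ℕ → ℕ → ℝ → ℝ → ℝ),
      (∀ α β : ℕ → ℝ,
        let k : ℝ → ℝ → ℝ := fun t z =>
          ∑ m ∈ range ((0:ℕ) + 1), α m * B 0 m t z + ∑ m ∈ range (0:ℕ), β m * B 1 m t z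
        ContDiff ℝ 2 (Function.uncurry k) ∧
        ((∀ m, Odd m → α m = 0) → (∀ m, Odd m → β m = 0) →
          IntegrableOn (fun z =>
            (deriv (k 0) z - ∑ m ∈ range ((0:ℕ) + 1), α m * ((m : ℝ) - (0:ℕ)) * z ^ ((m : ℝ) - (0:ℕ) - 1)) ^ 2
            + P z * (k 0 z - ∑ m ∈ range ((0:ℕ) + 1), α m * z ^ ((m : ℝ) - (0:ℕ))) ^ 2
            + (deriv (fun τ => k τ z) 0 - ∑ m ∈ range (0:ℕ), β m * z ^ ((m : ℝ) - (0:ℕ))) ^ 2) (Ioi 1) ∧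
          (∫ z in Ioi 1,
            ((deriv (k 0) z - ∑ m ∈ range ((0:ℕ) + 1), α m * ((m : ℝ) - (0:ℕ)) * z ^ ((m : ℝ) - (0:ℕ) - 1)) ^ 2
            + P z * (k 0 z - ∑ m ∈ range ((0:ℕ) + 1), α m * z ^ ((m : ℝ) - (0:ℕ))) ^ 2
            + (deriv (fun τ => k τ z) 0 - ∑ m ∈ range (0:ℕ), β m * z ^ ((m : ℝ) - (0:ℕ))) ^ 2))
            ≤ Kc * ε ^ 2 * (∑ m ∈ range ((0:ℕ) + 1), α m ^ 2 + ∑ m ∈ range (0:ℕ), β m ^ 2))) →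
    ∀ (φ F : ℝ → ℝ → ℝ), ContDiff ℝ 2 (Function.uncurry φ) → Continuous (Function.uncurry F) →
      (∀ t z, iteratedDeriv 2 (fun τ => φ τ z) t - iteratedDeriv 2 (φ t) z + P z * φ t z = F t z) →
      (∀ τ z, 1 ≤ z → F τ z = 0) →
      (∫⁻ z in Ioi 1, ENNReal.ofReal
        (deriv (fun τ => φ τ z) 0 ^ 2 + deriv (φ 0) z ^ 2 + P z * φ 0 z ^ 2)) < ⊤ →
    ∀ (Lp' Lm' : ℝ),
      Tendsto (fun t => ∫ z in Ioi (1 + |t|),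
        (deriv (fun τ => φ τ z) t ^ 2 + deriv (φ t) z ^ 2 + P z * φ t z ^ 2)) atTop (𝓝 Lp') →
      Tendsto (fun t => ∫ z in Ioi (1 + |t|),
        (deriv (fun τ => φ τ z) t ^ 2 + deriv (φ t) z ^ 2 + P z * φ t z ^ 2)) atBot (𝓝 Lm') →
    ∀ δ : ℝ, 0 < δ → ∃ a : ℝ,
      IntegrableOn (fun z =>
        deriv (fun τ => φ τ z - (∑ m ∈ range ((0:ℕ) + 1), (if m = 0 then a else 0) * B 0 m τ z
          + ∑ m ∈ range (0:ℕ), (0:ℝ) * B 1 m τ z)) 0 ^ 2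
        + deriv (fun y => φ 0 y - (∑ m ∈ range ((0:ℕ) + 1), (if m = 0 then a else 0) * B 0 m 0 y
          + ∑ m ∈ range (0:ℕ), (0:ℝ) * B 1 m 0 y)) z ^ 2
        + P z * (φ 0 z - (∑ m ∈ range ((0:ℕ) + 1), (if m = 0 then a else 0) * B 0 m 0 z
          + ∑ m ∈ range (0:ℕ), (0:ℝ) * B 1 m 0 z)) ^ 2) (Ioi 1) ∧
      (∫ z in Ioi 1, (deriv (fun τ => φ τ z - (∑ m ∈ range ((0:ℕ) + 1),
          (if m = 0 then a else 0) * B 0 m τ z + ∑ m ∈ range (0:ℕ), (0:ℝ) * B 1 m τ z)) 0 ^ 2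
        + deriv (fun y => φ 0 y - (∑ m ∈ range ((0:ℕ) + 1), (if m = 0 then a else 0) * B 0 m 0 y
          + ∑ m ∈ range (0:ℕ), (0:ℝ) * B 1 m 0 y)) z ^ 2
        + P z * (φ 0 z - (∑ m ∈ range ((0:ℕ) + 1), (if m = 0 then a else 0) * B 0 m 0 z
          + ∑ m ∈ range (0:ℕ), (0:ℝ) * B 1 m 0 z)) ^ 2))
        ≤ A * (Lp' + Lm') + Θ * (ε + r) * (∫ z in Ioi 1,
            (deriv (fun τ => φ τ z) 0 ^ 2 + deriv (φ 0) z ^ 2 + P z * φ 0 z ^ 2)) + δ :=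
  far_channel_claim_zero 0 rfl hKc

end Literature.Analysis.PDE
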